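import Summits.BirchSwinnertonDyer.BirchSwinnertonDyer.Theorems.ClassRecordThreeEulerHalvesAtThreeCartanSupplyNormOneSum
import Summits.BirchSwinnertonDyer.BirchSwinnertonDyer.Theorems.ClassRecordThreeEulerHalvesAtThreeCartanSupplyCubicPoints
import HarnessLib

/-!
# VIRTUAL REALISATION over a cyclotomic field, II — cubic characters of cyclic groups; the Borel subgroup of `GL₂(𝔽_q)`

Helper file riding `--supports stmt-BirchSwinnertonDyer-19109` (crux `EulerHalvesAtThree`; UNREGISTERED sub-line `Cruxes/EulerHalvesAtThree/Lines/cartan_corr`,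
seat `bsd-idea-10` g13). Ingredients for the monomial realisation of `χ_W` (file I = `…CartanSupplyMonomial`):
* §1 for a finite cyclic group `α` with `3 ∣ |α|` and a primitive cube root of unity `ζ ∈ kˣ`, the CUBIC CHARACTER `cubicChar : α →* kˣ` (a generator
  goes to `ζ`): `χ(x) = 1 ↔ x` is a cube `↔ x^{|α|/3} = 1` (`cubicChar_eq_one_iff_pow`, via the tree's `cyclic_cube_iff`), `χ(x)³ = 1`, and the trace
  identity `χ(x) + χ(x⁻¹) = 2` or `−1` according as `χ(x) = 1` or not (`val_add_val_inv`);
* §2 the BOREL SUBGROUP `borelSub q` (upper-triangular invertible matrices), its parametrisation `upperGL a d b = (a b; 0 d)` by `(𝔽_q^×)² × 𝔽_q`,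
  `|B| = q (q−1)²` (`card_borelSub`), the diagonal-ratio homomorphism `diagRatio : B → 𝔽_q^×`, `(a b; 0 d) ↦ a/d`, and the class data of `upperGL a d b`
  (trace, determinant, scalar iff `b = 0 ∧ a = d`, the conjugacy criterion `conj_upperGL_iff`, and the root lemmas `roots_parabolic` ∕ `roots_split`);
* §3 the centraliser of a PARABOLIC element (non-scalar, `Δ = 0`, `q` odd) has `q (q−1)` elements (`card_centralizer_parabolic`).
HONEST FRAMING: finite-group bookkeeping; nothing about NUM, crux 23422 ∕ 19109 or any summit statement is proved by this seat; BSD is proved for no curve.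
[folklore; cite: SerreLinearRepresentations1977 §5.1; Bump1997 §4.1]
-/

set_option linter.dupNamespace false
set_option autoImplicit false

noncomputable section

namespace Summit.BirchSwinnertonDyer.BirchSwinnertonDyer.Theorems.CartanSupply.Monomial

open Summit.BirchSwinnertonDyer.BirchSwinnertonDyer.Theorems.CartanDegree
open Summit.BirchSwinnertonDyer.BirchSwinnertonDyer.Theorems.CartanTorusCubeCut
open scoped Classical

/-! ## §1 The cubic character of a finite cyclic group -/

section cubic

variable {α : Type*} [Group α] [Fintype α] (hc : IsCyclic α) {k : Type*} [CommRing k] {ζ : kˣ}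

/-- A chosen generator of the cyclic group `α`. -/
def gen (hc : IsCyclic α) : α := Classical.choose (@IsCyclic.exists_generator α _ hc)

omit [Fintype α] in
/-- PROVED: `gen` generates. [folklore] -/
theorem gen_spec (x : α) : x ∈ Subgroup.zpowers (gen hc) := Classical.choose_spec (@IsCyclic.exists_generator α _ hc) x

/-- PROVED: `3 = ord ζ` divides the order of the generator when `3 ∣ |α|`. [folklore] -/
theorem orderOf_dvd_of_three_dvd (hζ : IsPrimitiveRoot ζ 3) (h3 : 3 ∣ Fintype.card α) : orderOf ζ ∣ orderOf (gen hc) := by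
  rw [← hζ.eq_orderOf, orderOf_eq_card_of_forall_mem_zpowers (gen_spec hc), Nat.card_eq_fintype_card]; exact h3

/-- **The cubic character** of `α` attached to the primitive cube root of unity `ζ`: the generator `gen` goes to `ζ`. -/
def cubicChar (hζ : IsPrimitiveRoot ζ 3) (h3 : 3 ∣ Fintype.card α) : α →* kˣ :=
  monoidHomOfForallMemZpowers (gen_spec hc) (orderOf_dvd_of_three_dvd hc hζ h3)

variable (hζ : IsPrimitiveRoot ζ 3) (h3 : 3 ∣ Fintype.card α)

/-- PROVED: the generator goes to `ζ`. [folklore] -/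
theorem cubicChar_gen : cubicChar hc hζ h3 (gen hc) = ζ := monoidHomOfForallMemZpowers_apply_gen _ _

/-- PROVED: `χ(gen ^ j) = ζ ^ j`. [folklore] -/
theorem cubicChar_zpow (j : ℤ) : cubicChar hc hζ h3 (gen hc ^ j) = ζ ^ j := by
  rw [map_zpow, cubicChar_gen]

/-- PROVED: `χ(x)³ = 1`. [folklore] -/
theorem cubicChar_pow_three (x : α) : cubicChar hc hζ h3 x ^ 3 = 1 := by
  obtain ⟨j, hj⟩ := Subgroup.mem_zpowers_iff.1 (gen_spec hc x)
  rw [← hj, cubicChar_zpow, ← zpow_natCast, ← zpow_mul, mul_comm, zpow_mul, zpow_natCast, hζ.pow_eq_one, one_zpow]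

/-- PROVED: **`χ(x) = 1` iff `x` is a cube.** [folklore] -/
theorem cubicChar_eq_one_iff (x : α) : cubicChar hc hζ h3 x = 1 ↔ ∃ y : α, y ^ 3 = x := by
  constructor
  · intro hx
    obtain ⟨j, hj⟩ := Subgroup.mem_zpowers_iff.1 (gen_spec hc x)
    rw [← hj, cubicChar_zpow] at hx
    obtain ⟨m, hm⟩ := (hζ.zpow_eq_one_iff_dvd j).1 hx
    refine ⟨gen hc ^ m, ?_⟩
    rw [← hj, hm, ← zpow_natCast, ← zpow_mul, mul_comm]
  · rintro ⟨y, rfl⟩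
    rw [map_pow, cubicChar_pow_three]

/-- PROVED: **`χ(x) = 1 ↔ x ^ (|α|/3) = 1`** (with the tree's `cyclic_cube_iff`). [folklore] -/
theorem cubicChar_eq_one_iff_pow (x : α) : cubicChar hc hζ h3 x = 1 ↔ x ^ (Fintype.card α / 3) = 1 := by
  haveI := hc
  rw [cubicChar_eq_one_iff, cyclic_cube_iff h3]

/-- PROVED: `(χ x : k)³ = 1`. [folklore] -/
theorem val_cubicChar_pow_three (x : α) : ((cubicChar hc hζ h3 x : kˣ) : k) ^ 3 = 1 := by
  rw [← Units.val_pow_eq_pow_val, cubicChar_pow_three, Units.val_one]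

/-- PROVED — **THE TRACE IDENTITY** `χ(x) + χ(x⁻¹) = 2` if `χ(x) = 1`, else `−1`. [folklore] -/
theorem val_add_val_inv [IsDomain k] (x : α) :
    ((cubicChar hc hζ h3 x : kˣ) : k) + ((cubicChar hc hζ h3 x⁻¹ : kˣ) : k) = if cubicChar hc hζ h3 x = 1 then 2 else -1 := by
  have hinv : (cubicChar hc hζ h3 x)⁻¹ = cubicChar hc hζ h3 x ^ 2 :=
    inv_eq_of_mul_eq_one_right (by rw [← pow_succ', cubicChar_pow_three])
  rw [map_inv, hinv, Units.val_pow_eq_pow_val]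
  by_cases h : cubicChar hc hζ h3 x = 1
  · rw [if_pos h, h, Units.val_one]; norm_num
  · rw [if_neg h]
    have hc1 : ((cubicChar hc hζ h3 x : kˣ) : k) ≠ 1 := fun e => h (Units.val_eq_one.1 e)
    have hfac : (((cubicChar hc hζ h3 x : kˣ) : k) - 1) * (((cubicChar hc hζ h3 x : kˣ) : k) ^ 2 + (cubicChar hc hζ h3 x : kˣ) + 1) = 0 := by
      linear_combination val_cubicChar_pow_three hc hζ h3 x
    linear_combination (mul_eq_zero.1 hfac).resolve_left (sub_ne_zero.2 hc1)

end cubic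

/-! ## §2 The Borel subgroup of `GL₂(𝔽_q)` -/

section borel

variable {q : ℕ} [Fact q.Prime]

/-- The BOREL SUBGROUP `B`: invertible upper-triangular matrices. -/
def borelSub (q : ℕ) [Fact q.Prime] : Subgroup (G q) where
  carrier := {g | (g : Mat q) 1 0 = 0}
  mul_mem' := by
    intro g h hg hh
    simp only [Set.mem_setOf_eq] at hg hh ⊢
    rw [(CubicPoints.mul_entries g h).1, hg, hh, zero_mul, mul_zero, add_zero]
  one_mem' := by
    simp only [Set.mem_setOf_eq, Units.val_one]
    exact Matrix.one_apply_ne (by decide)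
  inv_mem' := by
    intro g hg
    simp only [Set.mem_setOf_eq] at hg ⊢
    obtain ⟨h00, -⟩ := CubicPoints.diag_ne_zero_of_upper g hg
    have e10 := (CubicPoints.mul_entries g⁻¹ g).1
    rw [inv_mul_cancel, Units.val_one, Matrix.one_apply_ne (by decide), hg, mul_zero, add_zero] at e10
    exact (mul_eq_zero.1 e10.symm).resolve_right h00

/-- PROVED: membership in `B`. [folklore] -/
theorem mem_borelSub_iff (g : G q) : g ∈ borelSub q ↔ (g : Mat q) 1 0 = 0 := Iff.rfl

/-- The upper-triangular matrix `(a b; 0 d)` with unit diagonal entries, as an element of `GL₂(𝔽_q)`. -/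
def upperGL (a d : (ZMod q)ˣ) (b : ZMod q) : G q :=
  Matrix.GeneralLinearGroup.mkOfDetNeZero !![(a : ZMod q), b; 0, (d : ZMod q)]
    (by rw [Matrix.det_fin_two_of, mul_zero, sub_zero]; exact mul_ne_zero a.ne_zero d.ne_zero)

/-- PROVED: the matrix of `upperGL a d b`. [folklore] -/
theorem upperGL_coe (a d : (ZMod q)ˣ) (b : ZMod q) : ((upperGL a d b : G q) : Mat q) = !![(a : ZMod q), b; 0, (d : ZMod q)] := rfl

/-- PROVED: entries of `upperGL a d b`. [folklore] -/
theorem upperGL_entries (a d : (ZMod q)ˣ) (b : ZMod q) :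
    ((upperGL a d b : G q) : Mat q) 0 0 = a ∧ ((upperGL a d b : G q) : Mat q) 0 1 = b ∧
      ((upperGL a d b : G q) : Mat q) 1 0 = 0 ∧ ((upperGL a d b : G q) : Mat q) 1 1 = d := by
  rw [upperGL_coe]; simp

/-- PROVED: `upperGL a d b ∈ B`. [folklore] -/
theorem upperGL_mem (a d : (ZMod q)ˣ) (b : ZMod q) : upperGL a d b ∈ borelSub q := (upperGL_entries a d b).2.2.1

/-- PROVED: every element of `B` is an `upperGL`. [folklore] -/
theorem exists_upperGL_of_mem {g : G q} (hg : g ∈ borelSub q) : ∃ a d : (ZMod q)ˣ, ∃ b : ZMod q, upperGL a d b = g := by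
  obtain ⟨h00, h11⟩ := CubicPoints.diag_ne_zero_of_upper g hg
  refine ⟨Units.mk0 _ h00, Units.mk0 _ h11, (g : Mat q) 0 1, ?_⟩
  apply Units.ext
  rw [upperGL_coe]
  rw [mem_borelSub_iff] at hg
  ext i j; fin_cases i <;> fin_cases j <;> simp [hg]

/-- PROVED: the parametrisation is injective. [folklore] -/
theorem upperGL_injective : Function.Injective (fun p : (ZMod q)ˣ × (ZMod q)ˣ × ZMod q => upperGL p.1 p.2.1 p.2.2) := by
  rintro ⟨a, d, b⟩ ⟨a', d', b'⟩ h
  have h' := congrArg (fun g : G q => (g : Mat q)) h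
  simp only [upperGL_coe] at h'
  have e00 := congrFun (congrFun h' 0) 0
  have e01 := congrFun (congrFun h' 0) 1
  have e11 := congrFun (congrFun h' 1) 1
  simp only [Matrix.of_apply, Matrix.cons_val', Matrix.cons_val_zero, Matrix.cons_val_one, Matrix.cons_val_fin_one] at e00 e01 e11
  exact Prod.ext (Units.ext e00) (Prod.ext (Units.ext e11) e01)

/-- PROVED: `B` (as a finset) is the image of the parametrisation. [folklore] -/
theorem borel_eq_image : (Finset.univ.filter fun g : G q => (g : Mat q) 1 0 = 0) =
    Finset.univ.image (fun p : (ZMod q)ˣ × (ZMod q)ˣ × ZMod q => upperGL p.1 p.2.1 p.2.2) := by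
  ext g
  simp only [Finset.mem_filter, Finset.mem_univ, true_and, Finset.mem_image]
  constructor
  · intro hg
    obtain ⟨a, d, b, h⟩ := exists_upperGL_of_mem (g := g) hg
    exact ⟨⟨a, d, b⟩, h⟩
  · rintro ⟨p, rfl⟩
    exact upperGL_mem _ _ _

/-- PROVED: **`|B| = q (q − 1)²`** (finset form). [folklore] -/
theorem card_borel : (Finset.univ.filter fun g : G q => (g : Mat q) 1 0 = 0).card = q * (q - 1) ^ 2 := by
  rw [borel_eq_image, Finset.card_image_of_injective _ upperGL_injective, Finset.card_univ, Fintype.card_prod, Fintype.card_prod,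
    ZMod.card_units q, ZMod.card]
  ring

/-- PROVED: **`|B| = q (q − 1)²`**. [folklore] -/
theorem card_borelSub : Nat.card (borelSub q) = q * (q - 1) ^ 2 := by
  rw [← card_borel (q := q)]
  exact Nat.subtype_card _ (fun g => by simp only [Finset.mem_filter, Finset.mem_univ, true_and]; exact Iff.rfl)

/-- The first diagonal entry of an element of `B`, as a unit. -/
def diag0 (g : borelSub q) : (ZMod q)ˣ := Units.mk0 (((g : G q) : Mat q) 0 0) (CubicPoints.diag_ne_zero_of_upper (g : G q) g.2).1

/-- The second diagonal entry of an element of `B`, as a unit. -/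
def diag1 (g : borelSub q) : (ZMod q)ˣ := Units.mk0 (((g : G q) : Mat q) 1 1) (CubicPoints.diag_ne_zero_of_upper (g : G q) g.2).2

/-- PROVED: unfolding. [folklore] -/
theorem diag0_val (g : borelSub q) : (diag0 g : ZMod q) = ((g : G q) : Mat q) 0 0 := rfl

/-- PROVED: unfolding. [folklore] -/
theorem diag1_val (g : borelSub q) : (diag1 g : ZMod q) = ((g : G q) : Mat q) 1 1 := rfl

/-- **The diagonal-ratio homomorphism** `B → 𝔽_q^×`, `(a b; 0 d) ↦ a/d`. -/
def diagRatio : borelSub q →* (ZMod q)ˣ where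
  toFun g := diag0 g * (diag1 g)⁻¹
  map_one' := by
    apply Units.ext
    simp [diag0, diag1]
  map_mul' g h := by
    apply Units.ext
    obtain ⟨-, e00, e11⟩ := CubicPoints.mul_entries (g : G q) (h : G q)
    have hg : ((g : G q) : Mat q) 1 0 = 0 := g.2
    have hh : ((h : G q) : Mat q) 1 0 = 0 := h.2
    rw [hh, mul_zero, add_zero] at e00
    rw [hg, zero_mul, zero_add] at e11
    show ((diag0 (g * h) * (diag1 (g * h))⁻¹ : (ZMod q)ˣ) : ZMod q) = ((diag0 g * (diag1 g)⁻¹ * (diag0 h * (diag1 h)⁻¹) : (ZMod q)ˣ) : ZMod q)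
    simp only [Units.val_mul, Units.val_inv_eq_inv_val, diag0_val, diag1_val]
    rw [show ((g * h : borelSub q) : G q) = (g : G q) * (h : G q) from rfl, e00, e11, mul_inv]
    ring

/-- PROVED: the value of `diagRatio`. [folklore] -/
theorem diagRatio_val (g : borelSub q) : (diagRatio g : ZMod q) = ((g : G q) : Mat q) 0 0 * (((g : G q) : Mat q) 1 1)⁻¹ := by
  show ((diag0 g * (diag1 g)⁻¹ : (ZMod q)ˣ) : ZMod q) = _
  rw [Units.val_mul, Units.val_inv_eq_inv_val]; rfl

/-- PROVED: **`diagRatio (a b; 0 d) = a/d`.** [folklore] -/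
theorem diagRatio_upperGL (a d : (ZMod q)ˣ) (b : ZMod q) : diagRatio ⟨upperGL a d b, upperGL_mem a d b⟩ = a * d⁻¹ := by
  apply Units.ext
  rw [diagRatio_val, Units.val_mul, Units.val_inv_eq_inv_val]
  show ((upperGL a d b : G q) : Mat q) 0 0 * (((upperGL a d b : G q) : Mat q) 1 1)⁻¹ = _
  rw [(upperGL_entries a d b).1, (upperGL_entries a d b).2.2.2]

/-! ### Class data of `upperGL a d b` -/

/-- PROVED: trace and determinant of `upperGL a d b`. [folklore] -/
theorem trace_det_upperGL (a d : (ZMod q)ˣ) (b : ZMod q) :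
    ((upperGL a d b : G q) : Mat q).trace = a + d ∧ ((upperGL a d b : G q) : Mat q).det = a * d := by
  rw [upperGL_coe, Matrix.trace_fin_two_of, Matrix.det_fin_two_of, mul_zero, sub_zero]; exact ⟨rfl, rfl⟩

/-- PROVED: `upperGL a d b` is scalar iff `b = 0` and `a = d`. [folklore] -/
theorem isScalarMat_upperGL_iff (a d : (ZMod q)ˣ) (b : ZMod q) : IsScalarMat ((upperGL a d b : G q) : Mat q) ↔ b = 0 ∧ a = d := by
  obtain ⟨e00, e01, e10, e11⟩ := upperGL_entries a d b
  unfold IsScalarMat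
  rw [e00, e01, e10, e11]
  exact ⟨fun h => ⟨h.1, Units.ext h.2.2⟩, fun h => ⟨h.1, rfl, by rw [h.2]⟩⟩

/-- PROVED — **CONJUGACY CRITERION**: a non-scalar `g` is conjugate to `(a b; 0 d)` iff the latter is non-scalar with the trace and determinant of `g`.
[folklore] -/
theorem conj_upperGL_iff (g : G q) (hg : ¬ IsScalarMat (g : Mat q)) (a d : (ZMod q)ˣ) (b : ZMod q) :
    (∃ x : G q, x⁻¹ * g * x = upperGL a d b) ↔
      ¬ (b = 0 ∧ a = d) ∧ (a : ZMod q) + d = (g : Mat q).trace ∧ (a : ZMod q) * d = (g : Mat q).det := by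
  rw [NormOne.conj_iff g (upperGL a d b) hg, isScalarMat_upperGL_iff, (trace_det_upperGL a d b).1, (trace_det_upperGL a d b).2]

/-- PROVED — **ROOTS, parabolic case**: if `a + d = t`, `a d = δ` and `t² − 4δ = 0` then `a = d`. [folklore] -/
theorem roots_parabolic {a d t δ : ZMod q} (hs : a + d = t) (hp : a * d = δ) (hΔ : t ^ 2 - 4 * δ = 0) : a = d := by
  have h : (a - d) ^ 2 = 0 := by rw [← hΔ, ← hs, ← hp]; ring
  exact sub_eq_zero.1 (pow_eq_zero_iff (two_ne_zero) |>.1 h)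

/-- PROVED — **ROOTS, split case**: if `a + d = l + m` and `a d = l m` then `(a, d) = (l, m)` or `(m, l)`. [folklore] -/
theorem roots_split {a d l m : ZMod q} (hs : a + d = l + m) (hp : a * d = l * m) : (a = l ∧ d = m) ∨ (a = m ∧ d = l) := by
  have h : (a - l) * (a - m) = 0 := by
    have hd : d = l + m - a := by rw [← hs]; ring
    rw [hd] at hp
    linear_combination -hp
  rcases mul_eq_zero.1 h with h1 | h1
  · left
    refine ⟨sub_eq_zero.1 h1, ?_⟩
    rw [sub_eq_zero.1 h1] at hs
    exact add_left_cancel hs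
  · right
    refine ⟨sub_eq_zero.1 h1, ?_⟩
    rw [sub_eq_zero.1 h1, add_comm l m] at hs
    exact add_left_cancel hs

/-- PROVED: an upper-triangular matrix has a rational eigenvalue (its `(0,0)` entry). [folklore] -/
theorem hasRatEigenvalue_upperGL (a d : (ZMod q)ˣ) (b : ZMod q) : HasRatEigenvalue ((upperGL a d b : G q) : Mat q) := by
  refine ⟨a, ?_⟩
  rw [(trace_det_upperGL a d b).1, (trace_det_upperGL a d b).2]; ring

/-! ## §3 The centraliser of a parabolic element -/

/-- PROVED: the centraliser of `u = (a 1; 0 a)` is `{(x y; 0 x)}`: `q (q − 1)` elements. [folklore] -/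
theorem card_centralizer_jordan (a : (ZMod q)ˣ) :
    (Finset.univ.filter fun y : G q => y⁻¹ * upperGL a a 1 * y = upperGL a a 1).card = q * (q - 1) := by
  have hset : (Finset.univ.filter fun y : G q => y⁻¹ * upperGL a a 1 * y = upperGL a a 1) =
      Finset.univ.image (fun p : (ZMod q)ˣ × ZMod q => upperGL p.1 p.1 p.2) := by
    ext y
    rw [Finset.mem_filter, mul_assoc, inv_mul_eq_iff_eq_mul, ← Units.val_inj, Units.val_mul, Units.val_mul, upperGL_coe]
    simp only [Finset.mem_univ, true_and, Finset.mem_image]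
    constructor
    · intro h
      have h00 := congrFun (congrFun h 0) 0
      have h01 := congrFun (congrFun h 0) 1
      simp [Matrix.mul_apply, Fin.sum_univ_two] at h00 h01
      -- `h00 : a y₀₀ + y₁₀ = y₀₀ a`, `h01 : a y₀₁ + y₁₁ = y₀₀ + y₀₁ a`
      have hy10 : (y : Mat q) 1 0 = 0 := by linear_combination h00
      have hy : (y : Mat q) 0 0 = (y : Mat q) 1 1 := by linear_combination -h01
      obtain ⟨c, e, b, hyp⟩ := exists_upperGL_of_mem (g := y) hy10
      refine ⟨⟨c, b⟩, ?_⟩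
      have hce : c = e := by
        apply Units.ext
        have e1 := (upperGL_entries c e b).1
        have e2 := (upperGL_entries c e b).2.2.2
        rw [hyp] at e1 e2
        rw [← e1, ← e2]; exact hy
      show upperGL c c b = y
      rw [← hyp, hce]
    · rintro ⟨⟨c, b⟩, rfl⟩
      rw [upperGL_coe]
      ext i j; fin_cases i <;> fin_cases j <;> simp [Matrix.mul_apply, Fin.sum_univ_two] <;> ring
  rw [hset, Finset.card_image_of_injective _ (fun p p' h => ?_), Finset.card_univ, Fintype.card_prod, ZMod.card_units q, ZMod.card, mul_comm]
  have := upperGL_injective (q := q) (a₁ := ⟨p.1, p.1, p.2⟩) (a₂ := ⟨p'.1, p'.1, p'.2⟩) h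
  simp only [Prod.mk.injEq] at this
  exact Prod.ext this.1 this.2.2

/-- PROVED — **THE CENTRALISER OF A PARABOLIC ELEMENT** (non-scalar, `Δ = 0`, `q` odd) has `q (q − 1)` elements: it is conjugate to `(a 1; 0 a)`,
`a = tr/2`. [folklore] -/
theorem card_centralizer_parabolic (hq2 : q ≠ 2) (g : G q) (hns : ¬ IsScalarMat (g : Mat q))
    (hΔ : (g : Mat q).trace ^ 2 - 4 * (g : Mat q).det = 0) :
    (Finset.univ.filter fun y : G q => y⁻¹ * g * y = g).card = q * (q - 1) := by
  have h2 : (2 : ZMod q) ≠ 0 := (ManinLocalTwoThree.SL2ZModOddPrime.neZero_two hq2).out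
  obtain ⟨hdet0⟩ : (g : Mat q).det ≠ 0 ∧ True := ⟨Matrix.GeneralLinearGroup.det_ne_zero g, trivial⟩
  -- `a = tr g / 2`, `det g = a²`
  have hdet : (g : Mat q).det = ((g : Mat q).trace * 2⁻¹) * ((g : Mat q).trace * 2⁻¹) := by
    have h4 : (4 : ZMod q) ≠ 0 := by
      have : (4 : ZMod q) = 2 * 2 := by norm_num
      rw [this]; exact mul_ne_zero h2 h2
    apply mul_left_cancel₀ h4
    have e : 4 * (g : Mat q).det = (g : Mat q).trace ^ 2 := by linear_combination -hΔ
    rw [e]; field_simp; ring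
  have ha0 : (g : Mat q).trace * 2⁻¹ ≠ 0 := fun h => hdet0 (by rw [hdet, h, mul_zero])
  have hu := conj_upperGL_iff g hns (Units.mk0 _ ha0) (Units.mk0 _ ha0) 1
  rw [Units.val_mk0] at hu
  have hsum : (g : Mat q).trace * 2⁻¹ + (g : Mat q).trace * 2⁻¹ = (g : Mat q).trace := by
    rw [← mul_two, mul_assoc, inv_mul_cancel₀ h2, mul_one]
  obtain ⟨z, hz⟩ := hu.2 ⟨fun h => one_ne_zero h.1, hsum, hdet.symm⟩
  rw [NormOne.card_centralizer_conj g _ z hz, card_centralizer_jordan]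

end borel

end Summit.BirchSwinnertonDyer.BirchSwinnertonDyer.Theorems.CartanSupply.Monomial

end
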